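import Literature.Computability.Complexity.CHIteratedAddition
import HarnessLib

/-!
# Residues of long numbers modulo short moduli inside the counting hierarchy

Fifth toolkit file (theorems only) of the scaled-up `FOM + MAJ` calculus: the passage from binary
to the Chinese remainder representation (Hesse–Allender–Barrington 2002, Lemma 4.1: "for each
modulus `mᵢ` and each `j < n` we must calculate `2ʲ mod mᵢ`, add the results using iterated
addition, and take the result modulo `mᵢ`"), scaled up to `CH` as in Bürgisser (ECCC TR06-113,
proof of Thm. 3.4, direction "⇒"):

* `powModGraph_mem_P`: the graph of modular exponentiation `(a, e, m) ↦ aᵉ mod m` (`m ≥ 2`) is in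
  `P` (the brick `modExpFn`), so `2ʲ mod m` is available for exponentially large `j`;
* `bitPowModSum_graph_mem_CH` / `bitPowModSum_mod_eq`: for a family of long numbers `G u` with a
  `CH` bit predicate and `G u < 2^{2^{r|u|}}`, the function
  `⟨u, m⟩ ↦ (∑_{j<2^{r|u|}} bit_j(G u) · (2ʲ mod m)) mod m` has a `CH` graph and equals
  `G u mod m` for `m ≥ 2` — the residues of a `CH`-definable long number modulo all short moduli
  are `CH`-definable.

## References

* W. Hesse, E. Allender, D. A. M. Barrington, JCSS 65 (2002), Lemma 4.1.
* P. Bürgisser, ECCC TR06-113 (2006), Thm. 3.4 and its proof.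
-/

namespace Literature.Computability.Complexity

open _root_.Computability Polynomial PRelSigma TTClosure Brick PPSharpP ThresholdPP Plumb Finset

/-! ### Modular exponentiation as a `P` atom -/

/-- The value of the modular-exponentiation brick on an arbitrary string `w = ⟨a, ⟨e, m⟩⟩`:
`aᵉ mod m` for `m ≥ 2`, else `0`. [folklore] -/
theorem bitsToNat_modExpFn (w : List Bool) :
    bitsToNat (modExpFn w) =
      if bitsToNat (sndP (sndP w)) ≤ 1 then 0
      else bitsToNat (fstP w) ^ bitsToNat (fstP (sndP w)) % bitsToNat (sndP (sndP w)) := by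
  unfold modExpFn modExpVal fstP sndP
  split_ifs with h
  · rfl
  · exact bitsToNat_encodeNat _

/-- **The graph of `(a, e, m) ↦ aᵉ mod m` (`m ≥ 2`; value `0` for `m ≤ 1`) is in `P`.** [cite: AroraBarak2009, §1.3] -/
theorem powModGraph_mem_P :
    ({z | (if bitsToNat (sndP (sndP (fstP z))) ≤ 1 then 0
        else bitsToNat (fstP (fstP z)) ^ bitsToNat (fstP (sndP (fstP z))) % bitsToNat (sndP (sndP (fstP z)))) =
      bitsToNat (sndP z)} : Language Bool) ∈ Classes.P :=
  mem_P_of_iff (graphFP_mem_P modExpFn_mem_FP) _ fun z => by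
    change _ ↔ bitsToNat (modExpFn (fstP z)) = bitsToNat (sndP z)
    rw [bitsToNat_modExpFn]
    rfl

/-- The modular power is below the modulus, hence below `2^{|w|}`. [folklore] -/
theorem powMod_lt_two_pow (w : List Bool) :
    (if bitsToNat (sndP (sndP w)) ≤ 1 then 0
      else bitsToNat (fstP w) ^ bitsToNat (fstP (sndP w)) % bitsToNat (sndP (sndP w))) <
      2 ^ (X : Polynomial ℕ).eval w.length := by
  rw [eval_X]
  split_ifs with h
  · exact Nat.two_pow_pos _
  · refine (Nat.mod_lt _ (by omega)).trans ((bitsToNat_lt _).trans_le (Nat.pow_le_pow_right (by norm_num) ?_))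
    exact (Nat.le_add_left _ _).trans (length_components_le w)

/-! ### Binary to Chinese remainder representation (HAB Lemma 4.1, scaled) -/

section BinToCRR

variable {G : List Bool → ℕ} (r : Polynomial ℕ)

/-- Binary expansion as a sum: `N = ∑_{j<B} 2ʲ · bit_j(N)` for `N < 2ᴮ`. [folklore] -/
theorem eq_sum_two_pow_mul_testBit {N B : ℕ} (h : N < 2 ^ B) :
    N = ∑ j ∈ range B, 2 ^ j * (N.testBit j).toNat := by
  rw [← mod_two_pow_eq_sum_testBit, Nat.mod_eq_of_lt h]

/-- **Reduction of a binary expansion modulo `m`**: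
`(∑_{j<B} bit_j(N) · (2ʲ mod m)) mod m = N mod m` for `N < 2ᴮ`. [cite: HesseAllenderBarrington2002, Lemma 4.1] -/
theorem sum_testBit_mul_pow_mod (N B m : ℕ) (h : N < 2 ^ B) :
    (∑ j ∈ range B, (if N.testBit j = true then 2 ^ j % m else 0)) % m = N % m := by
  conv_rhs => rw [eq_sum_two_pow_mul_testBit h, Finset.sum_nat_mod]
  congr 1
  refine sum_congr rfl fun j _ => ?_
  cases N.testBit j <;> simp

/-- The summand of the residue sum on `w' = ⟨w, bin j⟩`, `w = ⟨u, m⟩`: `2ʲ mod m` if bit `j` of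
`G u` is set (and `m ≥ 2`), else `0`. Its graph is in `CH` when the bits of `G` are. [folklore] -/
theorem resTermGraph_mem_CH (hG : {z | (G (fstP z)).testBit (bitsToNat (sndP z)) = true} ∈ CH) :
    {z | (if (G (fstP (fstP (fstP z)))).testBit (bitsToNat (sndP (fstP z))) = true then
          (if bitsToNat (sndP (fstP (fstP z))) ≤ 1 then 0
            else 2 ^ bitsToNat (sndP (fstP z)) % bitsToNat (sndP (fstP (fstP z))))
        else 0) = bitsToNat (sndP z)} ∈ CH := by
  -- the condition: bit `val (sndP w')` of `G (fstP (fstP w'))`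
  have hC : ({w | (G (fstP (fstP w))).testBit (bitsToNat (sndP w)) = true} : Language Bool) ∈ CH :=
    mem_CH_of_iff (preimage_mem_CH hG (pairFn_mem_FP (comp_mem_FP fstP_mem_FP fstP_mem_FP) sndP_mem_FP)) _ fun w => by
      change _ ↔ (G (fstP (pairFn (fstP ∘ fstP) sndP w))).testBit (bitsToNat (sndP (pairFn (fstP ∘ fstP) sndP w))) = true
      rw [pairFn_apply, fstP_boolPair, sndP_boolPair]; rfl
  -- the `then` branch: `2^{val (sndP w')} mod val (sndP (fstP w'))`, a recoding of the `powMod` atom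
  have hF : pairFn (fun _ => encodeNat 2) (pairFn sndP (sndP ∘ fstP)) ∈ FP :=
    pairFn_mem_FP (const_mem_FP _) (pairFn_mem_FP sndP_mem_FP (comp_mem_FP sndP_mem_FP fstP_mem_FP))
  have hthen := graph_comp_FP_mem_CH
    (f := fun w => if bitsToNat (sndP (sndP w)) ≤ 1 then 0
      else bitsToNat (fstP w) ^ bitsToNat (fstP (sndP w)) % bitsToNat (sndP (sndP w)))
    (P_subset_CH powModGraph_mem_P) hF
  have hthen' : {z | (if bitsToNat (sndP (fstP (fstP z))) ≤ 1 then 0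
      else 2 ^ bitsToNat (sndP (fstP z)) % bitsToNat (sndP (fstP (fstP z)))) = bitsToNat (sndP z)} ∈ CH :=
    mem_CH_of_iff hthen _ fun z => by
      change _ ↔ (if bitsToNat (sndP (sndP (pairFn (fun _ => encodeNat 2) (pairFn sndP (sndP ∘ fstP)) (fstP z)))) ≤ 1 then 0
        else bitsToNat (fstP (pairFn (fun _ => encodeNat 2) (pairFn sndP (sndP ∘ fstP)) (fstP z))) ^
          bitsToNat (fstP (sndP (pairFn (fun _ => encodeNat 2) (pairFn sndP (sndP ∘ fstP)) (fstP z)))) %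
          bitsToNat (sndP (sndP (pairFn (fun _ => encodeNat 2) (pairFn sndP (sndP ∘ fstP)) (fstP z))))) = bitsToNat (sndP z)
      simp only [pairFn_apply, Function.comp_apply, fstP_boolPair, sndP_boolPair, bitsToNat_encodeNat]
      rfl
  have hzero : {z | (fun _ : List Bool => (0 : ℕ)) (fstP z) = bitsToNat (sndP z)} ∈ CH :=
    mem_CH_of_iff (P_subset_CH (preimage_mem_P valZero_mem_P sndP_mem_FP)) _ fun z => by
      change (0 : ℕ) = bitsToNat (sndP z) ↔ bitsToNat (sndP z) = 0
      exact eq_comm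
  exact iteGraph_mem_CH' hC
    (f := fun w => if bitsToNat (sndP (fstP w)) ≤ 1 then 0 else 2 ^ bitsToNat (sndP w) % bitsToNat (sndP (fstP w)))
    (g := fun _ => 0) hthen' hzero

/-- Bit-size of the residue summand: `< 2^{|w'|}`. [folklore] -/
theorem resTerm_lt_two_pow (G : List Bool → ℕ) (w : List Bool) :
    (if (G (fstP (fstP w))).testBit (bitsToNat (sndP w)) = true then
        (if bitsToNat (sndP (fstP w)) ≤ 1 then 0 else 2 ^ bitsToNat (sndP w) % bitsToNat (sndP (fstP w)))
      else 0) < 2 ^ (X : Polynomial ℕ).eval w.length := by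
  rw [eval_X]
  split_ifs with h1 h2
  · exact Nat.two_pow_pos _
  · refine (Nat.mod_lt _ (by omega)).trans ((bitsToNat_lt _).trans_le (Nat.pow_le_pow_right (by norm_num) ?_))
    have a := length_fstF_sndF_le w
    have b := length_fstF_sndF_le (fstP w)
    change 2 * (fstP w).length + (sndP w).length ≤ _ at a
    change 2 * (fstP (fstP w)).length + (sndP (fstP w)).length ≤ _ at b
    omega
  · exact Nat.two_pow_pos _

/-- **The residue sum has a `CH` graph**: on `w = ⟨u, m⟩`,
`S w = ∑_{j < 2^{r|u|}} bit_j(G u) · (2ʲ mod val m)` (sum rule over the bit positions). [cite: HesseAllenderBarrington2002, Lemma 4.1] -/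
theorem bitPowModSum_graph_mem_CH (hG : {z | (G (fstP z)).testBit (bitsToNat (sndP z)) = true} ∈ CH) :
    {z | (∑ j ∈ range (2 ^ r.eval (fstP (fstP z)).length),
        (if (G (fstP (fstP z))).testBit j = true then
          (if bitsToNat (sndP (fstP z)) ≤ 1 then 0 else 2 ^ j % bitsToNat (sndP (fstP z))) else 0)) =
      bitsToNat (sndP z)} ∈ CH := by
  refine mem_CH_of_iff (sumGraph_fst_mem_CH (resTermGraph_mem_CH hG) (resTerm_lt_two_pow G) r) _ fun z => ?_
  change _ ↔ (∑ i ∈ range (2 ^ r.eval (fstP (fstP z)).length), _) = bitsToNat (sndP z)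
  simp only [fstP_boolPair, sndP_boolPair, bitsToNat_encodeNat]
  exact Iff.rfl

/-- **Bit-size of the residue sum**: `S ⟨u, m⟩ < 2^{(r + X + 1)(|w|)}`. [folklore] -/
theorem bitPowModSum_lt_two_pow (G : List Bool → ℕ) (w : List Bool) :
    (∑ j ∈ range (2 ^ r.eval (fstP w).length),
        (if (G (fstP w)).testBit j = true then
          (if bitsToNat (sndP w) ≤ 1 then 0 else 2 ^ j % bitsToNat (sndP w)) else 0)) <
      2 ^ (r + X + 1).eval w.length := by
  have hterm : ∀ j ∈ range (2 ^ r.eval (fstP w).length),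
      (if (G (fstP w)).testBit j = true then
          (if bitsToNat (sndP w) ≤ 1 then 0 else 2 ^ j % bitsToNat (sndP w)) else 0) ≤ 2 ^ w.length := by
    intro j _
    split_ifs with h1 h2
    · exact Nat.zero_le _
    · exact ((Nat.mod_lt _ (by omega)).trans ((bitsToNat_lt _).trans_le
        (Nat.pow_le_pow_right (by norm_num) ((Nat.le_add_left _ _).trans (length_components_le' w))))).le
    · exact Nat.zero_le _
  refine (sum_le_sum hterm).trans_lt ?_
  rw [sum_const, card_range, smul_eq_mul, ← pow_add]
  refine Nat.pow_lt_pow_right (by norm_num) ?_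
  simp only [eval_add, eval_X, eval_one]
  have := TM2Iter.eval_mono r (length_fstP_le w)
  omega
where
  /-- `|sndP w| ≤ |w|` (components are shorter). [folklore] -/
  length_components_le' (w : List Bool) : (fstP w).length + (sndP w).length ≤ w.length := by
    have a := length_fstF_sndF_le w
    change 2 * (fstP w).length + (sndP w).length ≤ _ at a
    omega

/-- **Residues of a long number are the reduced residue sums** (HAB Lemma 4.1): if
`G u < 2^{2^{r|u|}}` then for `m ≥ 2`, `S ⟨u, m⟩ mod m = G u mod m`. [cite: HesseAllenderBarrington2002, Lemma 4.1] -/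
theorem bitPowModSum_mod_eq (hGlt : ∀ u, G u < 2 ^ 2 ^ r.eval u.length) (w : List Bool) (hm : 2 ≤ bitsToNat (sndP w)) :
    (∑ j ∈ range (2 ^ r.eval (fstP w).length),
        (if (G (fstP w)).testBit j = true then
          (if bitsToNat (sndP w) ≤ 1 then 0 else 2 ^ j % bitsToNat (sndP w)) else 0)) % bitsToNat (sndP w) =
      G (fstP w) % bitsToNat (sndP w) := by
  rw [← sum_testBit_mul_pow_mod (G (fstP w)) (2 ^ r.eval (fstP w).length) (bitsToNat (sndP w)) (hGlt _)]
  congr 1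
  refine sum_congr rfl fun j _ => ?_
  simp only [show ¬ bitsToNat (sndP w) ≤ 1 by omega, if_false]

/-- **Residues of a `CH`-definable long number modulo short moduli are `CH`-definable**
(HAB Lemma 4.1 scaled up to `CH`; Bürgisser 2006, proof of Thm. 3.4): on `w = ⟨u, m⟩` the function
`S w mod val m` has a `CH` graph; by `bitPowModSum_mod_eq` it is `G u mod val m` whenever
`val m ≥ 2`. [cite: Burgisser2006, Theorem 3.4] -/
theorem modLongGraph_mem_CH (hG : {z | (G (fstP z)).testBit (bitsToNat (sndP z)) = true} ∈ CH) :
    {z | (∑ j ∈ range (2 ^ r.eval (fstP (fstP z)).length),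
        (if (G (fstP (fstP z))).testBit j = true then
          (if bitsToNat (sndP (fstP z)) ≤ 1 then 0 else 2 ^ j % bitsToNat (sndP (fstP z))) else 0)) %
        bitsToNat (sndP (fstP z)) = bitsToNat (sndP z)} ∈ CH := by
  have hm : {z | bitsToNat (sndP (fstP z)) = bitsToNat (sndP z)} ∈ CH :=
    mem_CH_of_iff (P_subset_CH (preimage_mem_P eqVal_mem_P (pairFn_mem_FP (comp_mem_FP sndP_mem_FP fstP_mem_FP) sndP_mem_FP)))
      _ fun z => by
        change _ ↔ bitsToNat (fstP (pairFn (sndP ∘ fstP) sndP z)) = bitsToNat (sndP (pairFn (sndP ∘ fstP) sndP z))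
        rw [pairFn_apply, fstP_boolPair, sndP_boolPair]; rfl
  exact comp₂_graph_mem_CH (op := fun a b => a % b) (P_subset_CH modGraph_mem_P)
    (bitPowModSum_graph_mem_CH r hG) (bitPowModSum_lt_two_pow r G)
    (f₂ := fun w => bitsToNat (sndP w)) (p₂ := X) hm (fun w => (bitsToNat_lt (sndP w)).trans_le
      (Nat.pow_le_pow_right (by norm_num) (by
        rw [eval_X]
        have a := length_fstF_sndF_le w
        change 2 * (fstP w).length + (sndP w).length ≤ _ at a
        omega)))

end BinToCRR

end Literature.Computability.Complexity
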